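import Summits.QuantumAdvantage.QuantumAdvantage.Theorems.SosSandwichThm23QueriesOfAAQ
import Literature.Barriers.QuantumAdvantage.RandomOracleMethodThm23
import HarnessLib

/-!
# Aaronson–Ambainis Thm. 7 (iii) — `P = P^{#P} ⟹ BQP^A ⊆ AvgP^A` a.s. — needs only the AA conjecture for QUERY algorithms

Support theorem for route `SosSandwich` (crux `PseudoBoundedAA`, stmt-QuantumAdvantage-15237; calibration of the route's
analytic input, sequel of `Theorems/SosSandwichThm23QueriesOfAAQ.lean`).  The tree proves Aaronson–Ambainis' Thm. 7 (iii)
(`Literature/Barriers/QuantumAdvantage/RandomOracleMethodHolds.lean`: `aaronsonAmbainis2014_thm7iii_holds :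
AAConjecture → P = PSharpP → ∀ᵐ A, BQP^A ⊆ AvgP^A`) in two halves: the MACHINE half
(`Thm23Machine.thm23_machine`: under `P = P^{#P}` every uniform Clifford+T oracle family has a polynomial-time transcript
machine computing the thresholded explicit tree `[simTreeOn c 2^{-k} F x ≥ 1/2]` — which does NOT use the conjecture) and the
PROBABILISTIC half (`ae_BQPRel_subset_AvgPRel_of_apxMachines`, from claim (apx): the machine errs about the `BQP`-promise bit
only on a set of oracles of measure `< 1/n³`).  The conjecture enters only through claim (apx), i.e. through
`measure_simTreeOn_threshold_lt`; replacing that by its `AA_Q` twin (`measure_simTreeOn_deviation_lt_of_aaQuery` of the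
prequel, via the circuit→query bridge) gives

* `measure_simTreeOn_threshold_lt_of_aaQuery` — the thresholded (apx) event from `AA_Q`;
* `thm23_apx_of_aaQuery_of_machines` — claim (apx) with polynomial-time machines, from `AA_Q` and the machine half ALONE
  (hypothesis `hmach` = the conclusion of `thm23_dyadicMachines` WITHOUT its — unused — conjecture-body argument; it is
  discharged verbatim by `fun c k => Thm23Machine.thm23_machine c k`, sequel `…Thm7iiiOfAAQFinal.lean`, kept apart only
  because of the size of the machine module's import closure);
* **`thm7iii_of_aaQuery_of_machines`** — `AA_Q → P = PSharpP → ∀ᵐ A ∂randomOracleMeasure, BQP^A ⊆ AvgP^A` granted `hmach`;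
* `P_ne_PSharpP_of_separation_of_aaQuery_of_machines` — the barrier reading: granted `AA_Q` (and `hmach`), an almost-sure
  separation of `BQP` from `AvgP` by a random oracle refutes `P = P^{#P}`.

Here `AA_Q` is the Aaronson–Ambainis influence bound for the cube values of acceptance probabilities of quantum query
algorithms only (inline as in `QueryRestrict.quantumQuerySimulable_of_aaQuery`; by Escudero Gutiérrez' Thm. 1.4 — outputs of
`d`-query algorithms = degree-`≤ 2d` polynomials of Fourier completely bounded `2d`-norm `≤ 1` — it is the even-degree case of
his Conjecture 1.5, strictly between the full conjecture and nothing known).  Honest label: calibration; `AA_Q` open.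
No named fact; axioms standard.
Sources: AaronsonAmbainis2014 Thm. 7 (iii), Thm. 23 (proof, p. 14); EscuderoGutierrez2023 Thm. 1.4, Conj. 1.5.
-/

noncomputable section
-- D-0017: single-conjunct summit ⇒ the duplicate `QuantumAdvantage.QuantumAdvantage` is mandated.
set_option linter.dupNamespace false

namespace Summit.QuantumAdvantage.QuantumAdvantage.Theorems.SosSandwich.QueryCrux

open MeasureTheory _root_.Computability Literature.Computability.Complexity Literature.Computability.Complexity.Classes
  Literature.Computability.Cryptography Literature.Computability.QuantumComplexity Literature.Barriers.QuantumAdvantage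
open scoped ENNReal

variable {c : ℕ} {C₀ : ℝ}

/-- **Thresholded form of (apx) for the explicit tree, from `AA_Q`** (twin of `measure_simTreeOn_threshold_lt`): the event "the
`BQP` promise holds for `F^A` at `x` but `[p̃_x(A) ≥ 1/2]` is not the promised answer" has probability `< 1/n³`.
[cite: AaronsonAmbainis2014, Thm. 23 (proof, p. 14) with proof of Cor. 22] -/
theorem measure_simTreeOn_threshold_lt_of_aaQuery {G : QGateSet} (hC₀ : 0 < C₀)
    (H : ∀ (N : ℕ) (Q : QQueryAlg N) (p : MvPolynomial (Fin N) ℝ) (ε : ℝ),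
      1 ≤ Q.queries → (∀ x, evalBool p x = Q.acceptProb x) → 0 < ε → ε ≤ boolVariance p →
        ∃ i : Fin N, C₀ * (ε / Q.queries) ^ c ≤ influence i p)
    (hG : G.IsUnitary) (F : QCircuitFamily G) (x : List Bool) (hn : 1 ≤ x.length) :
    randomOracleMeasure {A : Set (List Bool) |
        (2 / 3 ≤ F.acceptProbOn A x ∧
            decide (1 / 2 ≤ (simTreeOn c C₀ F x).eval (oracleBits F x A)) ≠ true) ∨
          (F.acceptProbOn A x ≤ 1 / 3 ∧
            decide (1 / 2 ≤ (simTreeOn c C₀ F x).eval (oracleBits F x A)) ≠ false)} <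
      ENNReal.ofReal (1 / (x.length : ℝ) ^ 3) := by
  refine lt_of_le_of_lt (measure_mono fun A hA => ?_) (measure_simTreeOn_deviation_lt_of_aaQuery hC₀ H hG F x hn)
  simp only [Set.mem_setOf_eq, ne_eq, decide_eq_true_eq, decide_eq_false_iff_not, not_le, not_lt] at hA ⊢
  rcases hA with ⟨hp, ht⟩ | ⟨hp, ht⟩
  · rw [abs_sub_comm, abs_of_nonneg (by linarith)]; linarith
  · rw [abs_of_nonneg (by linarith)]; linarith

/-- Rounding the constant of `AA_Q` down (a smaller constant is a weaker claim). [folklore] -/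
theorem aaQueryBody_mono {C₁ : ℝ} (hle : C₁ ≤ C₀)
    (H : ∀ (N : ℕ) (Q : QQueryAlg N) (p : MvPolynomial (Fin N) ℝ) (ε : ℝ),
      1 ≤ Q.queries → (∀ x, evalBool p x = Q.acceptProb x) → 0 < ε → ε ≤ boolVariance p →
        ∃ i : Fin N, C₀ * (ε / Q.queries) ^ c ≤ influence i p) :
    ∀ (N : ℕ) (Q : QQueryAlg N) (p : MvPolynomial (Fin N) ℝ) (ε : ℝ),
      1 ≤ Q.queries → (∀ x, evalBool p x = Q.acceptProb x) → 0 < ε → ε ≤ boolVariance p →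
        ∃ i : Fin N, C₁ * (ε / Q.queries) ^ c ≤ influence i p := by
  intro N Q p ε hT hp hε hv
  obtain ⟨i, hi⟩ := H N Q p ε hT hp hε hv
  refine ⟨i, le_trans ?_ hi⟩
  have hT' : (0 : ℝ) < Q.queries := by exact_mod_cast hT
  exact mul_le_mul_of_nonneg_right hle (by positivity)

/-- **Claim (apx) of the proof of Thm. 23, from `AA_Q` and `P = P^{#P}`**: every uniform Clifford+T oracle family has a
polynomial-time transcript machine with a polynomial round/query-length budget whose answer is wrong about the `BQP`-promise bit
of `F^A` at an input of length `n ≥ 1` only on a set of oracles of measure `< 1/n³` — granted the machine half `hmach`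
(= `Thm23Machine.thm23_machine`, unconditional in the conjecture); probability: `measure_simTreeOn_threshold_lt_of_aaQuery`
(constant rounded down to `2^{-k}`). [cite: AaronsonAmbainis2014, Thm. 23 (proof, p. 14)] -/
theorem thm23_apx_of_aaQuery_of_machines
    (hmach : ∀ (c k : ℕ), P = PSharpP → ∀ F : QCircuitFamily cliffordT, F.IsUniform →
      ∃ (C : OracleAlg Bool) (q : Polynomial ℕ), C.IsPolyTime encodingBoolBool ∧
        (∀ (A : Language Bool) (x : List Bool),
          ∀ y ∈ C.queries (Oracle.ofLanguage A) (q.eval x.length) x, y.length ≤ q.eval x.length) ∧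
        ∀ (A : Language Bool) (x : List Bool), 1 ≤ x.length →
          C.run (Oracle.ofLanguage A) (q.eval x.length) x =
            some (decide (1 / 2 ≤ (simTreeOn c ((2 : ℝ)⁻¹ ^ k) F x).eval (oracleBits F x A))))
    (hAAQ : ∃ (c : ℕ) (C : ℝ), 0 < C ∧ ∀ (N : ℕ) (Q : QQueryAlg N) (p : MvPolynomial (Fin N) ℝ) (ε : ℝ),
      1 ≤ Q.queries → (∀ x, evalBool p x = Q.acceptProb x) → 0 < ε → ε ≤ boolVariance p →
        ∃ i : Fin N, C * (ε / Q.queries) ^ c ≤ influence i p)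
    (hP : P = PSharpP) :
    ∀ F : QCircuitFamily cliffordT, F.IsUniform →
      ∃ (C : OracleAlg Bool) (q : Polynomial ℕ), C.IsPolyTime encodingBoolBool ∧
        (∀ (A : Language Bool) (x : List Bool),
          ∀ y ∈ C.queries (Oracle.ofLanguage A) (q.eval x.length) x, y.length ≤ q.eval x.length) ∧
        ∀ x : List Bool, 1 ≤ x.length →
          randomOracleMeasure (badEvent F C q x) < ENNReal.ofReal (1 / (x.length : ℝ) ^ 3) := by
  intro F hF
  obtain ⟨c, C₀, hC₀, H⟩ := hAAQ
  -- round the constant down to a power of `2`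
  obtain ⟨k, hk⟩ := exists_pow_lt_of_lt_one hC₀ (by norm_num : (2 : ℝ)⁻¹ < 1)
  have H' := aaQueryBody_mono hk.le H
  have hC₁ : (0 : ℝ) < (2 : ℝ)⁻¹ ^ k := by positivity
  obtain ⟨C, q, hpoly, hq, hrun⟩ := hmach c k hP F hF
  refine ⟨C, q, hpoly, hq, fun x hn => ?_⟩
  have hev := measure_simTreeOn_threshold_lt_of_aaQuery (c := c) (C₀ := (2 : ℝ)⁻¹ ^ k) hC₁ H'
    cliffordT_isUnitary_holds F x hn
  refine lt_of_le_of_lt (measure_mono fun A hA => ?_) hev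
  unfold badEvent at hA
  simp only [Set.mem_setOf_eq] at hA ⊢
  rw [hrun A x hn] at hA
  simpa only [ne_eq, Option.some.injEq] using hA

/-- **Aaronson–Ambainis 2014, Thm. 7 (iii), from `AA_Q` and the machine half**: if the Aaronson–Ambainis influence bound
holds for the acceptance probabilities of quantum QUERY algorithms and `P = P^{#P}`, then `BQP^A ⊆ AvgP^A` with probability `1`
for a random oracle `A` (the tree's `aaronsonAmbainis2014_thm7iii_holds` assumes the full conjecture for all bounded
low-degree polynomials; `hmach` is discharged by `Thm23Machine.thm23_machine` in the sequel). [cite: AaronsonAmbainis2014, Thm. 7 (iii), Thm. 23] -/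
theorem thm7iii_of_aaQuery_of_machines
    (hmach : ∀ (c k : ℕ), P = PSharpP → ∀ F : QCircuitFamily cliffordT, F.IsUniform →
      ∃ (C : OracleAlg Bool) (q : Polynomial ℕ), C.IsPolyTime encodingBoolBool ∧
        (∀ (A : Language Bool) (x : List Bool),
          ∀ y ∈ C.queries (Oracle.ofLanguage A) (q.eval x.length) x, y.length ≤ q.eval x.length) ∧
        ∀ (A : Language Bool) (x : List Bool), 1 ≤ x.length →
          C.run (Oracle.ofLanguage A) (q.eval x.length) x =
            some (decide (1 / 2 ≤ (simTreeOn c ((2 : ℝ)⁻¹ ^ k) F x).eval (oracleBits F x A))))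
    (hAAQ : ∃ (c : ℕ) (C : ℝ), 0 < C ∧ ∀ (N : ℕ) (Q : QQueryAlg N) (p : MvPolynomial (Fin N) ℝ) (ε : ℝ),
      1 ≤ Q.queries → (∀ x, evalBool p x = Q.acceptProb x) → 0 < ε → ε ≤ boolVariance p →
        ∃ i : Fin N, C * (ε / Q.queries) ^ c ≤ influence i p)
    (hP : P = PSharpP) :
    ∀ᵐ A ∂randomOracleMeasure,
      BQPRel (A : Language Bool) ⊆ Literature.Computability.Complexity.AvgPRel (Oracle.ofLanguage (A : Language Bool)) :=
  ae_BQPRel_subset_AvgPRel_of_apxMachines (thm23_apx_of_aaQuery_of_machines hmach hAAQ hP)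

/-- **The barrier reading, from `AA_Q`** (twin of `P_ne_PSharpP_of_randomOracle_separation`): granted the Aaronson–Ambainis
bound for quantum query acceptance probabilities (and the machine half), an almost-sure random-oracle separation of `BQP` from
`AvgP` refutes `P = P^{#P}`. [cite: AaronsonAmbainis2014, §1 (p. 5) and Thm. 7 (iii)] -/
theorem P_ne_PSharpP_of_separation_of_aaQuery_of_machines
    (hmach : ∀ (c k : ℕ), P = PSharpP → ∀ F : QCircuitFamily cliffordT, F.IsUniform →
      ∃ (C : OracleAlg Bool) (q : Polynomial ℕ), C.IsPolyTime encodingBoolBool ∧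
        (∀ (A : Language Bool) (x : List Bool),
          ∀ y ∈ C.queries (Oracle.ofLanguage A) (q.eval x.length) x, y.length ≤ q.eval x.length) ∧
        ∀ (A : Language Bool) (x : List Bool), 1 ≤ x.length →
          C.run (Oracle.ofLanguage A) (q.eval x.length) x =
            some (decide (1 / 2 ≤ (simTreeOn c ((2 : ℝ)⁻¹ ^ k) F x).eval (oracleBits F x A))))
    (hAAQ : ∃ (c : ℕ) (C : ℝ), 0 < C ∧ ∀ (N : ℕ) (Q : QQueryAlg N) (p : MvPolynomial (Fin N) ℝ) (ε : ℝ),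
      1 ≤ Q.queries → (∀ x, evalBool p x = Q.acceptProb x) → 0 < ε → ε ≤ boolVariance p →
        ∃ i : Fin N, C * (ε / Q.queries) ^ c ≤ influence i p)
    (hsep : ¬ ∀ᵐ A ∂randomOracleMeasure,
      BQPRel (A : Language Bool) ⊆ Literature.Computability.Complexity.AvgPRel (Oracle.ofLanguage (A : Language Bool))) :
    P ≠ PSharpP :=
  fun hP => hsep (thm7iii_of_aaQuery_of_machines hmach hAAQ hP)

end Summit.QuantumAdvantage.QuantumAdvantage.Theorems.SosSandwich.QueryCrux
end
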